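import Summits.CriticalPhenomena.PercolationContinuityZ3.Theorems.PercNearOneGluingNoHeavyLowerTailSahiH4PlusOrThree
import Summits.CriticalPhenomena.PercolationContinuityZ3.Theorems.PercNearOneGluingNoHeavyLowerTailSahiE4UnionCoinFourMeasure
import Summits.CriticalPhenomena.PercolationContinuityZ3.Theorems.PercNearOneGluingNoHeavyLowerTailSahiE4UnionCoinFourMeasureP3
import Summits.CriticalPhenomena.PercolationContinuityZ3.Theorems.PercNearOneGluingNoHeavyLowerTailSahiE4UnionRowFacts
import Summits.CriticalPhenomena.PercolationContinuityZ3.Theorems.PercNearOneGluingNoHeavyLowerTailSahiE3UnionTensorMeasure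
import Summits.CriticalPhenomena.PercolationContinuityZ3.Theorems.PercNearOneGluingNoHeavyLowerTailSahiE3UnionTensorLattice
import Mathlib.Tactic.FinCases
import HarnessLib

/-!
# `NoHeavyLowerTail` (crux stmt-CriticalPhenomena-4575), Sahi programme P4 — ★ `H₄⁺` SURVIVES THE OR WITH A COMMON INDEPENDENT EVENT
# (the four-member COIN block, packaged; the first `|K| = 4` closure step)

Support file (cell `prim-l12`, seat P4, generation 38; `--supports stmt-CriticalPhenomena-4575`).  No definitions, no named facts, no sorries;
standard axioms.  `γ` a finite preorder, `μ` a positively associated probability weight (`SahiPositive μ 2`), `a : Fin 4 → γ → [0,1]` monotone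
with `H4Plus μ a` (`E₃` sub-triples, six product rows, `E₄`); `β` ANY finite type with a probability weight `ν` and an event `c : β → {0,1}`.
THEOREM `h4Plus_orCoinFour`: `H4Plus (μ⊗ν) (a ∨ c)` for `u_i(x,y) = a_i(x) + c(y) − a_i(x)c(y)` — the block `b = (c,c,c,c)` feeds ALL FOUR members
(not covered by `h4Plus_orBlock`, which needs an unfed member).  Ingredients: the coin rungs `SahiE4UnionCoinFour.sahiE_four_orCoinFour_nonneg` /
`sahiE_three_prodRow01_orCoinFour_nonneg` (explicit decompositions along the homogeneous components of `E₄` / of the product row in fail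
coordinates), relabelled for the six product rows, and the three-member coin for the `E₃` rows (`SahiE3UnionTensor.sahiE_three_por_nonneg`);
Harris rows of `a` from positive association (`SahiE4UnionHold.rowH_/rowF_`).  HONEST FRAMING: a special four-member block; the general
`|K| = 4` step is open. [this work]
-/

noncomputable section

namespace Summit.CriticalPhenomena.PercolationContinuityZ3.Theorems.SahiH4Plus

open Finset Function Literature.Combinatorics.Sahi2008
open Summit.CriticalPhenomena.PercolationContinuityZ3.Theorems.SahiE4UnionHold
open Summit.CriticalPhenomena.PercolationContinuityZ3.Theorems.SahiE4UnionCoinFour (sahiE_four_orCoinFour_nonneg sahiE_three_prodRow01_orCoinFour_nonneg)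
open Summit.CriticalPhenomena.PercolationContinuityZ3.Theorems.SahiE4UnionPairBlock (sahiE_three_swap01 sahiE_three_swap12)

variable {γ β : Type*} [Fintype γ] [Fintype β] [Preorder γ]

/-- `E₄` is symmetric: relabelling `(0, 3, 1, 2)`. [folklore] -/
theorem sahiE_four_perm0312 {α : Type*} [Fintype α] (μ : α → ℝ) (a : Fin 4 → α → ℝ) : sahiE μ 4 ![a 0, a 3, a 1, a 2] = sahiE μ 4 a := by
  have h := sahiE_comp_perm μ 4 ((Equiv.swap (1 : Fin 4) 2).trans (Equiv.swap (2 : Fin 4) 3)) a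
  have e : (fun i => a (((Equiv.swap (1 : Fin 4) 2).trans (Equiv.swap (2 : Fin 4) 3)) i)) = ![a 0, a 3, a 1, a 2] := by
    funext i; fin_cases i <;> rfl
  rw [e] at h; exact h

/-- `E₄` is symmetric: relabelling `(1, 3, 0, 2)`. [folklore] -/
theorem sahiE_four_perm1302 {α : Type*} [Fintype α] (μ : α → ℝ) (a : Fin 4 → α → ℝ) : sahiE μ 4 ![a 1, a 3, a 0, a 2] = sahiE μ 4 a := by
  have h := sahiE_comp_perm μ 4 (((Equiv.swap (0 : Fin 4) 1).trans (Equiv.swap (0 : Fin 4) 2)).trans (Equiv.swap (2 : Fin 4) 3)) a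
  have e : (fun i => a ((((Equiv.swap (0 : Fin 4) 1).trans (Equiv.swap (0 : Fin 4) 2)).trans (Equiv.swap (2 : Fin 4) 3)) i)) = ![a 1, a 3, a 0, a 2] := by
    funext i; fin_cases i <;> rfl
  rw [e] at h; exact h

/-- `E₄` is symmetric: relabelling `(2, 3, 0, 1)`. [folklore] -/
theorem sahiE_four_perm2301 {α : Type*} [Fintype α] (μ : α → ℝ) (a : Fin 4 → α → ℝ) : sahiE μ 4 ![a 2, a 3, a 0, a 1] = sahiE μ 4 a := by
  have h := sahiE_comp_perm μ 4 ((Equiv.swap (0 : Fin 4) 2).trans (Equiv.swap (1 : Fin 4) 3)) a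
  have e : (fun i => a (((Equiv.swap (0 : Fin 4) 2).trans (Equiv.swap (1 : Fin 4) 3)) i)) = ![a 2, a 3, a 0, a 1] := by
    funext i; fin_cases i <;> rfl
  rw [e] at h; exact h

/-- `E₄` is symmetric: relabelling `(0, 2, 1, 3)`. [folklore] -/
theorem sahiE_four_swap12x {α : Type*} [Fintype α] (μ : α → ℝ) (a : Fin 4 → α → ℝ) : sahiE μ 4 ![a 0, a 2, a 1, a 3] = sahiE μ 4 a := by
  have h := sahiE_comp_perm μ 4 ((Equiv.swap (1 : Fin 4) 2)) a
  have e : (fun i => a (((Equiv.swap (1 : Fin 4) 2)) i)) = ![a 0, a 2, a 1, a 3] := by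
    funext i; fin_cases i <;> rfl
  rw [e] at h; exact h

/-- `E₄` is symmetric: relabelling `(1, 2, 0, 3)`. [folklore] -/
theorem sahiE_four_perm1203x {α : Type*} [Fintype α] (μ : α → ℝ) (a : Fin 4 → α → ℝ) : sahiE μ 4 ![a 1, a 2, a 0, a 3] = sahiE μ 4 a := by
  have h := sahiE_comp_perm μ 4 ((Equiv.swap (0 : Fin 4) 1).trans (Equiv.swap (0 : Fin 4) 2)) a
  have e : (fun i => a (((Equiv.swap (0 : Fin 4) 1).trans (Equiv.swap (0 : Fin 4) 2)) i)) = ![a 1, a 2, a 0, a 3] := by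
    funext i; fin_cases i <;> rfl
  rw [e] at h; exact h

/-- Lattice-level form of `SahiE4UnionCoinFour.sahiE_four_orCoinFour_nonneg` (Harris rows of `a` from positive association). [this work] -/
theorem coinFour_e4_lat (μ : γ → ℝ) (ν : β → ℝ)
    (hμ0 : ∀ t, 0 ≤ μ t) (hμ1 : ∑ t, μ t = 1) (hν0 : ∀ t, 0 ≤ ν t) (hν1 : ∑ t, ν t = 1) (hμ2 : SahiPositive μ 2)
    (a : Fin 4 → γ → ℝ) (ha0 : ∀ i t, 0 ≤ a i t) (ha1 : ∀ i t, a i t ≤ 1) (ham : ∀ i, Monotone (a i))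
    (c : β → ℝ) (hc : ∀ y, c y = 0 ∨ c y = 1)
    (hha_e3h_012 : 0 ≤ sahiE μ 3 ![a 0, a 1, a 2])
    (hha_e3h_013 : 0 ≤ sahiE μ 3 ![a 0, a 1, a 3])
    (hha_e3h_023 : 0 ≤ sahiE μ 3 ![a 0, a 2, a 3])
    (hha_e3h_123 : 0 ≤ sahiE μ 3 ![a 1, a 2, a 3])
    (hha_p3h_01 : 0 ≤ sahiE μ 3 ![a 0 * a 1, a 2, a 3])
    (hha_p3h_02 : 0 ≤ sahiE μ 3 ![a 0 * a 2, a 1, a 3])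
    (hha_p3h_12 : 0 ≤ sahiE μ 3 ![a 1 * a 2, a 0, a 3])
    (hha_p3h_03 : 0 ≤ sahiE μ 3 ![a 0 * a 3, a 1, a 2])
    (hha_p3h_13 : 0 ≤ sahiE μ 3 ![a 1 * a 3, a 0, a 2])
    (hha_p3h_23 : 0 ≤ sahiE μ 3 ![a 2 * a 3, a 0, a 1])
    (hha_e4h : 0 ≤ sahiE μ 4 a)
    : 0 ≤ sahiE (fun p : γ × β => μ p.1 * ν p.2) 4 (fun (i : Fin 4) (p : γ × β) => a i p.1 + c p.2 - a i p.1 * c p.2) :=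
  sahiE_four_orCoinFour_nonneg μ ν hμ0 hμ1 hν0 hν1 a (fun _ => c) ha0 ha1 c hc (fun _ => rfl)
    (by have h := rowH_0_1 μ hμ2 a ha0 ham; linarith) (by have h := rowH_0_2 μ hμ2 a ha0 ham; linarith) (by have h := rowH_0_12 μ hμ2 a ha0 ham; linarith) (by have h := rowH_0_3 μ hμ2 a ha0 ham; linarith) (by have h := rowH_0_13 μ hμ2 a ha0 ham; linarith) (by have h := rowH_0_23 μ hμ2 a ha0 ham; linarith) (by have h := rowH_0_123 μ hμ2 a ha0 ham; linarith) (by have h := rowH_1_2 μ hμ2 a ha0 ham; linarith) (by have h := rowH_1_02 μ hμ2 a ha0 ham; linarith) (by have h := rowH_1_3 μ hμ2 a ha0 ham; linarith) (by have h := rowH_1_03 μ hμ2 a ha0 ham; linarith) (by have h := rowH_1_23 μ hμ2 a ha0 ham; linarith) (by have h := rowH_1_023 μ hμ2 a ha0 ham; linarith) (by have h := rowH_01_2 μ hμ2 a ha0 ham; linarith) (by have h := rowH_01_3 μ hμ2 a ha0 ham; linarith) (by have h := rowH_01_23 μ hμ2 a ha0 ham; linarith) (by have h := rowH_2_3 μ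 hμ2 a ha0 ham; linarith) (by have h := rowH_2_03 μ hμ2 a ha0 ham; linarith) (by have h := rowH_2_13 μ hμ2 a ha0 ham; linarith) (by have h := rowH_2_013 μ hμ2 a ha0 ham; linarith) (by have h := rowH_02_3 μ hμ2 a ha0 ham; linarith) (by have h := rowH_02_13 μ hμ2 a ha0 ham; linarith) (by have h := rowH_12_3 μ hμ2 a ha0 ham; linarith) (by have h := rowH_12_03 μ hμ2 a ha0 ham; linarith) (by have h := rowH_012_3 μ hμ2 a ha0 ham; linarith) (by have h := rowF_0_1 μ hμ1 hμ2 a ha0 ham; linarith) (by have h := rowF_0_2 μ hμ1 hμ2 a ha0 ham; linarith) (by have h := rowF_0_12 μ hμ1 hμ2 a ha0 ha1 ham; linarith) (by have h := rowF_0_3 μ hμ1 hμ2 a ha0 ham; linarith) (by have h := rowF_0_13 μ hμ1 hμ2 a ha0 ha1 ham; linarith) (by have h := rowF_0_23 μ hμ1 hμ2 a ha0 ha1 ham; linarith) (by have h := rowF_0_123 μ hμ1 hμ2 a ha0 ha1 ham; linarith) (by have h := rowF_1_2 μ hμ1 hμ2 a ha0 ham; linarith) (by have h := rowF_1_02 μ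 hμ1 hμ2 a ha0 ha1 ham; linarith) (by have h := rowF_1_3 μ hμ1 hμ2 a ha0 ham; linarith) (by have h := rowF_1_03 μ hμ1 hμ2 a ha0 ha1 ham; linarith) (by have h := rowF_1_23 μ hμ1 hμ2 a ha0 ha1 ham; linarith) (by have h := rowF_1_023 μ hμ1 hμ2 a ha0 ha1 ham; linarith) (by have h := rowF_01_2 μ hμ1 hμ2 a ha0 ha1 ham; linarith) (by have h := rowF_01_3 μ hμ1 hμ2 a ha0 ha1 ham; linarith) (by have h := rowF_01_23 μ hμ1 hμ2 a ha0 ha1 ham; linarith) (by have h := rowF_2_3 μ hμ1 hμ2 a ha0 ham; linarith) (by have h := rowF_2_03 μ hμ1 hμ2 a ha0 ha1 ham; linarith) (by have h := rowF_2_13 μ hμ1 hμ2 a ha0 ha1 ham; linarith) (by have h := rowF_2_013 μ hμ1 hμ2 a ha0 ha1 ham; linarith) (by have h := rowF_02_3 μ hμ1 hμ2 a ha0 ha1 ham; linarith) (by have h := rowF_02_13 μ hμ1 hμ2 a ha0 ha1 ham; linarith) (by have h := rowF_12_3 μ hμ1 hμ2 a ha0 ha1 ham; linarith) (by have h := rowF_12_03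 μ hμ1 hμ2 a ha0 ha1 ham; linarith) (by have h := rowF_012_3 μ hμ1 hμ2 a ha0 ha1 ham; linarith)
    hha_e3h_012 hha_e3h_013 hha_e3h_023 hha_e3h_123 hha_p3h_01 hha_p3h_02 hha_p3h_12 hha_p3h_03 hha_p3h_13 hha_p3h_23 hha_e4h

/-- Lattice-level form of `SahiE4UnionCoinFour.sahiE_three_prodRow01_orCoinFour_nonneg` (Harris rows of `a` from positive association). [this work] -/
theorem coinFour_p3_lat (μ : γ → ℝ) (ν : β → ℝ)
    (hμ0 : ∀ t, 0 ≤ μ t) (hμ1 : ∑ t, μ t = 1) (hν0 : ∀ t, 0 ≤ ν t) (hν1 : ∑ t, ν t = 1) (hμ2 : SahiPositive μ 2)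
    (a : Fin 4 → γ → ℝ) (ha0 : ∀ i t, 0 ≤ a i t) (ha1 : ∀ i t, a i t ≤ 1) (ham : ∀ i, Monotone (a i))
    (c : β → ℝ) (hc : ∀ y, c y = 0 ∨ c y = 1)
    (hha_e3h_012 : 0 ≤ sahiE μ 3 ![a 0, a 1, a 2])
    (hha_e3h_013 : 0 ≤ sahiE μ 3 ![a 0, a 1, a 3])
    (hha_e3h_023 : 0 ≤ sahiE μ 3 ![a 0, a 2, a 3])
    (hha_e3h_123 : 0 ≤ sahiE μ 3 ![a 1, a 2, a 3])
    (hha_p3h_01 : 0 ≤ sahiE μ 3 ![a 0 * a 1, a 2, a 3])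
    (hha_p3h_02 : 0 ≤ sahiE μ 3 ![a 0 * a 2, a 1, a 3])
    (hha_p3h_12 : 0 ≤ sahiE μ 3 ![a 1 * a 2, a 0, a 3])
    (hha_p3h_03 : 0 ≤ sahiE μ 3 ![a 0 * a 3, a 1, a 2])
    (hha_p3h_13 : 0 ≤ sahiE μ 3 ![a 1 * a 3, a 0, a 2])
    (hha_p3h_23 : 0 ≤ sahiE μ 3 ![a 2 * a 3, a 0, a 1])
    (hha_e4h : 0 ≤ sahiE μ 4 a)
    : 0 ≤ sahiE (fun p : γ × β => μ p.1 * ν p.2) 3 ![(fun (i : Fin 4) (p : γ × β) => a i p.1 + c p.2 - a i p.1 * c p.2) 0 * (fun (i : Fin 4) (p : γ × β) => a i p.1 + c p.2 - a i p.1 * c p.2) 1, (fun (i : Fin 4) (p : γ × β) => a i p.1 + c p.2 - a i p.1 * c p.2) 2, (fun (i : Fin 4) (p : γ × β) => a i p.1 + c p.2 - a i p.1 * c p.2) 3] :=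
  sahiE_three_prodRow01_orCoinFour_nonneg μ ν hμ0 hμ1 hν0 hν1 a (fun _ => c) ha0 ha1 c hc (fun _ => rfl)
    (by have h := rowH_0_1 μ hμ2 a ha0 ham; linarith) (by have h := rowH_0_2 μ hμ2 a ha0 ham; linarith) (by have h := rowH_0_12 μ hμ2 a ha0 ham; linarith) (by have h := rowH_0_3 μ hμ2 a ha0 ham; linarith) (by have h := rowH_0_13 μ hμ2 a ha0 ham; linarith) (by have h := rowH_0_23 μ hμ2 a ha0 ham; linarith) (by have h := rowH_0_123 μ hμ2 a ha0 ham; linarith) (by have h := rowH_1_2 μ hμ2 a ha0 ham; linarith) (by have h := rowH_1_02 μ hμ2 a ha0 ham; linarith) (by have h := rowH_1_3 μ hμ2 a ha0 ham; linarith) (by have h := rowH_1_03 μ hμ2 a ha0 ham; linarith) (by have h := rowH_1_23 μ hμ2 a ha0 ham; linarith) (by have h := rowH_1_023 μ hμ2 a ha0 ham; linarith) (by have h := rowH_01_2 μ hμ2 a ha0 ham; linarith) (by have h := rowH_01_3 μ hμ2 a ha0 ham; linarith) (by have h := rowH_01_23 μ hμ2 a ha0 ham; linarith) (by have h := rowH_2_3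 μ hμ2 a ha0 ham; linarith) (by have h := rowH_2_03 μ hμ2 a ha0 ham; linarith) (by have h := rowH_2_13 μ hμ2 a ha0 ham; linarith) (by have h := rowH_2_013 μ hμ2 a ha0 ham; linarith) (by have h := rowH_02_3 μ hμ2 a ha0 ham; linarith) (by have h := rowH_02_13 μ hμ2 a ha0 ham; linarith) (by have h := rowH_12_3 μ hμ2 a ha0 ham; linarith) (by have h := rowH_12_03 μ hμ2 a ha0 ham; linarith) (by have h := rowH_012_3 μ hμ2 a ha0 ham; linarith) (by have h := rowF_0_1 μ hμ1 hμ2 a ha0 ham; linarith) (by have h := rowF_0_2 μ hμ1 hμ2 a ha0 ham; linarith) (by have h := rowF_0_12 μ hμ1 hμ2 a ha0 ha1 ham; linarith) (by have h := rowF_0_3 μ hμ1 hμ2 a ha0 ham; linarith) (by have h := rowF_0_13 μ hμ1 hμ2 a ha0 ha1 ham; linarith) (by have h := rowF_0_23 μ hμ1 hμ2 a ha0 ha1 ham; linarith) (by have h := rowF_0_123 μ hμ1 hμ2 a ha0 ha1 ham; linarith) (by have h := rowF_1_2 μ hμ1 hμ2 a ha0 ham; linarith) (by have h := rowF_1_02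 μ hμ1 hμ2 a ha0 ha1 ham; linarith) (by have h := rowF_1_3 μ hμ1 hμ2 a ha0 ham; linarith) (by have h := rowF_1_03 μ hμ1 hμ2 a ha0 ha1 ham; linarith) (by have h := rowF_1_23 μ hμ1 hμ2 a ha0 ha1 ham; linarith) (by have h := rowF_1_023 μ hμ1 hμ2 a ha0 ha1 ham; linarith) (by have h := rowF_01_2 μ hμ1 hμ2 a ha0 ha1 ham; linarith) (by have h := rowF_01_3 μ hμ1 hμ2 a ha0 ha1 ham; linarith) (by have h := rowF_01_23 μ hμ1 hμ2 a ha0 ha1 ham; linarith) (by have h := rowF_2_3 μ hμ1 hμ2 a ha0 ham; linarith) (by have h := rowF_2_03 μ hμ1 hμ2 a ha0 ha1 ham; linarith) (by have h := rowF_2_13 μ hμ1 hμ2 a ha0 ha1 ham; linarith) (by have h := rowF_2_013 μ hμ1 hμ2 a ha0 ha1 ham; linarith) (by have h := rowF_02_3 μ hμ1 hμ2 a ha0 ha1 ham; linarith) (by have h := rowF_02_13 μ hμ1 hμ2 a ha0 ha1 ham; linarith) (by have h := rowF_12_3 μ hμ1 hμ2 a ha0 ha1 ham; linarith) (by have h :=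 rowF_12_03 μ hμ1 hμ2 a ha0 ha1 ham; linarith) (by have h := rowF_012_3 μ hμ1 hμ2 a ha0 ha1 ham; linarith)
    hha_e3h_012 hha_e3h_013 hha_e3h_023 hha_e3h_123 hha_p3h_01 hha_p3h_02 hha_p3h_12 hha_p3h_03 hha_p3h_13 hha_p3h_23 hha_e4h

/-- **`H₄⁺` is preserved by the OR with an independent event common to all four members** (the four-member COIN block).
`γ` a finite preorder with a positively associated probability weight `μ`, `a : Fin 4 → γ → [0,1]` monotone with `H4Plus μ a`; `β` ANY finite
type with a probability weight `ν` and an event `c : β → {0,1}`; then the family `u_i(x,y) = a_i(x) ∨ c(y)` on `γ × β` satisfies `H4Plus (μ⊗ν) u`.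
The `E₄` and product rows are the coin rungs of `…SahiE4UnionCoinFour(Measure)`; the `E₃` rows of the sub-triples are the three-member coin
(`SahiE3UnionTensor.sahiE_three_por_nonneg` with `b = (c,c,c)`). [this work] -/
theorem h4Plus_orCoinFour (μ : γ → ℝ) (ν : β → ℝ)
    (hμ0 : ∀ t, 0 ≤ μ t) (hμ1 : ∑ t, μ t = 1) (hν0 : ∀ t, 0 ≤ ν t) (hν1 : ∑ t, ν t = 1) (hμ2 : SahiPositive μ 2)
    (a : Fin 4 → γ → ℝ) (ha0 : ∀ i t, 0 ≤ a i t) (ha1 : ∀ i t, a i t ≤ 1) (ham : ∀ i, Monotone (a i))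
    (c : β → ℝ) (hc : ∀ y, c y = 0 ∨ c y = 1) (h : H4Plus μ a) :
    H4Plus (fun p : γ × β => μ p.1 * ν p.2) (fun (i : Fin 4) (p : γ × β) => a i p.1 + c p.2 - a i p.1 * c p.2) := by
  have hc0 : ∀ y, 0 ≤ c y := fun y => by rcases hc y with e | e <;> simp [e]
  have hc1 : ∀ y, c y ≤ 1 := fun y => by rcases hc y with e | e <;> simp [e]
  have hc2 : c * c = c := by funext y; rcases hc y with e | e <;> simp [Pi.mul_apply, e]
  have hθ0 : 0 ≤ ex ν c := ex_nonneg hν0 hc0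
  have hθ1 : ex ν c ≤ 1 := by
    have t := ex_mono hν0 (fun y => show c y ≤ (fun _ => (1:ℝ)) y from hc1 y); rw [ex_const hν1] at t; exact t
  have hcc : ex ν (c * c) = ex ν c := by rw [hc2]
  have hccc : ex ν (c * c * c) = ex ν c := by rw [hc2, hc2]
  have hL : ex ν c * ex ν c ≤ ex ν (c * c) := by rw [hcc]; nlinarith
  have hS : ex ν (c * c) * ex ν c ≤ ex ν (c * c * c) := by rw [hcc, hccc]; nlinarith
  have heb : 0 ≤ sahiE ν 3 ![c, c, c] := by
    rw [sahiE_three, hccc, hcc]; nlinarith [mul_nonneg (mul_nonneg hθ0 (sub_nonneg.2 hθ1)) (show (0:ℝ) ≤ 2 - ex ν c by linarith)]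
  -- E₃ of the sub-triples: three-member coin
  have tri : ∀ (i j k : Fin 4), 0 ≤ sahiE μ 3 ![a i, a j, a k] →
      ex μ (a i) * ex μ (a j) ≤ ex μ (a i * a j) → ex μ (a i) * ex μ (a k) ≤ ex μ (a i * a k) → ex μ (a j) * ex μ (a k) ≤ ex μ (a j * a k) →
      ex μ (a j * a k) * ex μ (a i) ≤ ex μ (a i * a j * a k) → ex μ (a i * a k) * ex μ (a j) ≤ ex μ (a i * a j * a k) →
      ex μ (a i * a j) * ex μ (a k) ≤ ex μ (a i * a j * a k) →
      0 ≤ sahiE (fun p : γ × β => μ p.1 * ν p.2) 3 ![(fun (i : Fin 4) (p : γ × β) => a i p.1 + c p.2 - a i p.1 * c p.2) i,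
        (fun (i : Fin 4) (p : γ × β) => a i p.1 + c p.2 - a i p.1 * c p.2) j, (fun (i : Fin 4) (p : γ × β) => a i p.1 + c p.2 - a i p.1 * c p.2) k] := by
    intro i j k he k1 k2 k3 r0 r1 r2
    have h3 := SahiE3UnionTensor.sahiE_three_por_nonneg μ ν hμ0 hμ1 hν0 hν1 ![a i, a j, a k] ![c, c, c]
      (fun l t => by fin_cases l <;> exact ha0 _ t) (fun l t => by fin_cases l <;> exact ha1 _ t)
      (fun l t => by fin_cases l <;> exact hc0 t) (fun l t => by fin_cases l <;> exact hc1 t)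
      k1 k2 k3 r0 r1 r2 he hL hL hL hS hS hS heb
    have e : (fun (l : Fin 3) (p : γ × β) => (![a i, a j, a k] : Fin 3 → γ → ℝ) l p.1 + (![c, c, c] : Fin 3 → β → ℝ) l p.2
        - (![a i, a j, a k] : Fin 3 → γ → ℝ) l p.1 * (![c, c, c] : Fin 3 → β → ℝ) l p.2)
        = ![(fun (i : Fin 4) (p : γ × β) => a i p.1 + c p.2 - a i p.1 * c p.2) i,
            (fun (i : Fin 4) (p : γ × β) => a i p.1 + c p.2 - a i p.1 * c p.2) j,
            (fun (i : Fin 4) (p : γ × β) => a i p.1 + c p.2 - a i p.1 * c p.2) k] := by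
      funext l p; fin_cases l <;> rfl
    rw [e] at h3; exact h3
  have R : ∀ (i j : Fin 4), ex μ (a i) * ex μ (a j) ≤ ex μ (a i * a j) := fun i j =>
    SahiE3UnionTensor.ex_mul_le_of_sahiPositive_two μ hμ2 (a i) (a j) (ha0 i) (ha0 j) (ham i) (ham j)
  have R21 : ∀ (i j k : Fin 4), ex μ (a j * a k) * ex μ (a i) ≤ ex μ (a i * a j * a k) := by
    intro i j k
    have hjk0 : ∀ t, 0 ≤ (a j * a k) t := fun t => mul_nonneg (ha0 j t) (ha0 k t)
    have hjkm : Monotone (a j * a k) := (ham j).mul (ham k) (ha0 j) (ha0 k)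
    have t := SahiE3UnionTensor.ex_mul_le_of_sahiPositive_two μ hμ2 (a i) (a j * a k) (ha0 i) hjk0 (ham i) hjkm
    have e : a i * (a j * a k) = a i * a j * a k := by funext t; simp only [Pi.mul_apply]; ring
    rw [e] at t; linarith
  have R21b : ∀ (i j k : Fin 4), ex μ (a i * a k) * ex μ (a j) ≤ ex μ (a i * a j * a k) := by
    intro i j k
    have t := R21 j i k
    have e : a j * a i * a k = a i * a j * a k := by funext t; simp only [Pi.mul_apply]; ring
    rw [e] at t; linarith
  have R21c : ∀ (i j k : Fin 4), ex μ (a i * a j) * ex μ (a k) ≤ ex μ (a i * a j * a k) := by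
    intro i j k
    have t := R21 k i j
    have e : a k * a i * a j = a i * a j * a k := by funext t; simp only [Pi.mul_apply]; ring
    rw [e] at t; linarith
  refine ⟨?_, ?_, ?_, ?_, ?_, ?_, ?_, ?_, ?_, ?_, ?_⟩
  · exact tri 0 1 2 h.e3_012 (R 0 1) (R 0 2) (R 1 2) (R21 0 1 2) (R21b 0 1 2) (R21c 0 1 2)
  · exact tri 0 1 3 h.e3_013 (R 0 1) (R 0 3) (R 1 3) (R21 0 1 3) (R21b 0 1 3) (R21c 0 1 3)
  · exact tri 0 2 3 h.e3_023 (R 0 2) (R 0 3) (R 2 3) (R21 0 2 3) (R21b 0 2 3) (R21c 0 2 3)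
  · exact tri 1 2 3 h.e3_123 (R 1 2) (R 1 3) (R 2 3) (R21 1 2 3) (R21b 1 2 3) (R21c 1 2 3)
  -- p3_01: product-row coin rung for the relabelled family (0, 1, 2, 3)
  · exact coinFour_p3_lat μ ν hμ0 hμ1 hν0 hν1 hμ2 a ha0 ha1 ham c hc
      h.e3_012 h.e3_013 h.e3_023 h.e3_123 h.p3_01 h.p3_02 h.p3_12 h.p3_03 h.p3_13 h.p3_23 h.e4
  -- p3_02: product-row coin rung for the relabelled family (0, 2, 1, 3)
  · exact coinFour_p3_lat μ ν hμ0 hμ1 hν0 hν1 hμ2 ![a 0, a 2, a 1, a 3] (fun i t => by fin_cases i <;> exact ha0 _ t) (fun i t => by fin_cases i <;> exact ha1 _ t) (fun i => by fin_cases i <;> exact ham _) c hc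
      (by show 0 ≤ sahiE μ 3 ![a 0, a 2, a 1]; rw [sahiE_three_swap12 μ (a 0) (a 1) (a 2)]; exact h.e3_012) h.e3_023 h.e3_013 (by show 0 ≤ sahiE μ 3 ![a 2, a 1, a 3]; rw [sahiE_three_swap01 μ (a 1) (a 2) (a 3)]; exact h.e3_123) h.p3_02 h.p3_01 (by show 0 ≤ sahiE μ 3 ![a 2 * a 1, a 0, a 3]; rw [show a 2 * a 1 = a 1 * a 2 from mul_comm _ _]; exact h.p3_12) (by show 0 ≤ sahiE μ 3 ![a 0 * a 3, a 2, a 1]; rw [sahiE_three_swap12 μ (a 0 * a 3) (a 1) (a 2)]; exact h.p3_03) h.p3_23 h.p3_13 (by show 0 ≤ sahiE μ 4 ![a 0, a 2, a 1, a 3]; rw [sahiE_four_swap12x]; exact h.e4)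
  -- p3_12: product-row coin rung for the relabelled family (1, 2, 0, 3)
  · exact coinFour_p3_lat μ ν hμ0 hμ1 hν0 hν1 hμ2 ![a 1, a 2, a 0, a 3] (fun i t => by fin_cases i <;> exact ha0 _ t) (fun i t => by fin_cases i <;> exact ha1 _ t) (fun i => by fin_cases i <;> exact ham _) c hc
      (by show 0 ≤ sahiE μ 3 ![a 1, a 2, a 0]; rw [sahiE_three_swap12 μ (a 1) (a 0) (a 2), sahiE_three_swap01 μ (a 0) (a 1) (a 2)]; exact h.e3_012) h.e3_123 (by show 0 ≤ sahiE μ 3 ![a 1, a 0, a 3]; rw [sahiE_three_swap01 μ (a 0) (a 1) (a 3)]; exact h.e3_013) (by show 0 ≤ sahiE μ 3 ![a 2, a 0, a 3]; rw [sahiE_three_swap01 μ (a 0) (a 2) (a 3)]; exact h.e3_023) h.p3_12 (by show 0 ≤ sahiE μ 3 ![a 1 * a 0, a 2, a 3]; rw [show a 1 * a 0 = a 0 * a 1 from mul_comm _ _]; exact h.p3_01) (by show 0 ≤ sahiE μ 3 ![a 2 * a 0, a 1, a 3]; rw [show a 2 * a 0 = a 0 * a 2 from mul_comm _ _]; exact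 h.p3_02) (by show 0 ≤ sahiE μ 3 ![a 1 * a 3, a 2, a 0]; rw [sahiE_three_swap12 μ (a 1 * a 3) (a 0) (a 2)]; exact h.p3_13) (by show 0 ≤ sahiE μ 3 ![a 2 * a 3, a 1, a 0]; rw [sahiE_three_swap12 μ (a 2 * a 3) (a 0) (a 1)]; exact h.p3_23) h.p3_03 (by show 0 ≤ sahiE μ 4 ![a 1, a 2, a 0, a 3]; rw [sahiE_four_perm1203x]; exact h.e4)
  -- p3_03: product-row coin rung for the relabelled family (0, 3, 1, 2)
  · exact coinFour_p3_lat μ ν hμ0 hμ1 hν0 hν1 hμ2 ![a 0, a 3, a 1, a 2] (fun i t => by fin_cases i <;> exact ha0 _ t) (fun i t => by fin_cases i <;> exact ha1 _ t) (fun i => by fin_cases i <;> exact ham _) c hc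
      (by show 0 ≤ sahiE μ 3 ![a 0, a 3, a 1]; rw [sahiE_three_swap12 μ (a 0) (a 1) (a 3)]; exact h.e3_013) (by show 0 ≤ sahiE μ 3 ![a 0, a 3, a 2]; rw [sahiE_three_swap12 μ (a 0) (a 2) (a 3)]; exact h.e3_023) h.e3_012 (by show 0 ≤ sahiE μ 3 ![a 3, a 1, a 2]; rw [sahiE_three_swap01 μ (a 1) (a 3) (a 2), sahiE_three_swap12 μ (a 1) (a 2) (a 3)]; exact h.e3_123) h.p3_03 (by show 0 ≤ sahiE μ 3 ![a 0 * a 1, a 3, a 2]; rw [sahiE_three_swap12 μ (a 0 * a 1) (a 2) (a 3)]; exact h.p3_01) (by show 0 ≤ sahiE μ 3 ![a 3 * a 1, a 0, a 2]; rw [show a 3 * a 1 = a 1 * a 3 from mul_comm _ _]; exact h.p3_13) (by show 0 ≤ sahiE μ 3 ![a 0 * a 2, a 3, a 1]; rw [sahiE_three_swap12 μ (a 0 * a 2) (a 1) (a 3)]; exact h.p3_02) (by show 0 ≤ sahiE μ 3 ![a 3 * a 2, a 0, a 1]; rw [show a 3 * a 2 = a 2 * a 3 from mul_comm _ _]; exact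 h.p3_23) h.p3_12 (by show 0 ≤ sahiE μ 4 ![a 0, a 3, a 1, a 2]; rw [sahiE_four_perm0312]; exact h.e4)
  -- p3_13: product-row coin rung for the relabelled family (1, 3, 0, 2)
  · exact coinFour_p3_lat μ ν hμ0 hμ1 hν0 hν1 hμ2 ![a 1, a 3, a 0, a 2] (fun i t => by fin_cases i <;> exact ha0 _ t) (fun i t => by fin_cases i <;> exact ha1 _ t) (fun i => by fin_cases i <;> exact ham _) c hc
      (by show 0 ≤ sahiE μ 3 ![a 1, a 3, a 0]; rw [sahiE_three_swap12 μ (a 1) (a 0) (a 3), sahiE_three_swap01 μ (a 0) (a 1) (a 3)]; exact h.e3_013) (by show 0 ≤ sahiE μ 3 ![a 1, a 3, a 2]; rw [sahiE_three_swap12 μ (a 1) (a 2) (a 3)]; exact h.e3_123) (by show 0 ≤ sahiE μ 3 ![a 1, a 0, a 2]; rw [sahiE_three_swap01 μ (a 0) (a 1) (a 2)]; exact h.e3_012) (by show 0 ≤ sahiE μ 3 ![a 3, a 0, a 2]; rw [sahiE_three_swap01 μ (a 0) (a 3) (a 2), sahiE_three_swap12 μ (a 0) (a 2) (a 3)]; exact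 h.e3_023) h.p3_13 (by show 0 ≤ sahiE μ 3 ![a 1 * a 0, a 3, a 2]; rw [show a 1 * a 0 = a 0 * a 1 from mul_comm _ _, sahiE_three_swap12 μ (a 0 * a 1) (a 2) (a 3)]; exact h.p3_01) (by show 0 ≤ sahiE μ 3 ![a 3 * a 0, a 1, a 2]; rw [show a 3 * a 0 = a 0 * a 3 from mul_comm _ _]; exact h.p3_03) (by show 0 ≤ sahiE μ 3 ![a 1 * a 2, a 3, a 0]; rw [sahiE_three_swap12 μ (a 1 * a 2) (a 0) (a 3)]; exact h.p3_12) (by show 0 ≤ sahiE μ 3 ![a 3 * a 2, a 1, a 0]; rw [show a 3 * a 2 = a 2 * a 3 from mul_comm _ _, sahiE_three_swap12 μ (a 2 * a 3) (a 0) (a 1)]; exact h.p3_23) h.p3_02 (by show 0 ≤ sahiE μ 4 ![a 1, a 3, a 0, a 2]; rw [sahiE_four_perm1302]; exact h.e4)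
  -- p3_23: product-row coin rung for the relabelled family (2, 3, 0, 1)
  · exact coinFour_p3_lat μ ν hμ0 hμ1 hν0 hν1 hμ2 ![a 2, a 3, a 0, a 1] (fun i t => by fin_cases i <;> exact ha0 _ t) (fun i t => by fin_cases i <;> exact ha1 _ t) (fun i => by fin_cases i <;> exact ham _) c hc
      (by show 0 ≤ sahiE μ 3 ![a 2, a 3, a 0]; rw [sahiE_three_swap12 μ (a 2) (a 0) (a 3), sahiE_three_swap01 μ (a 0) (a 2) (a 3)]; exact h.e3_023) (by show 0 ≤ sahiE μ 3 ![a 2, a 3, a 1]; rw [sahiE_three_swap12 μ (a 2) (a 1) (a 3), sahiE_three_swap01 μ (a 1) (a 2) (a 3)]; exact h.e3_123) (by show 0 ≤ sahiE μ 3 ![a 2, a 0, a 1]; rw [sahiE_three_swap01 μ (a 0) (a 2) (a 1), sahiE_three_swap12 μ (a 0) (a 1) (a 2)]; exact h.e3_012) (by show 0 ≤ sahiE μ 3 ![a 3, a 0, a 1]; rw [sahiE_three_swap01 μ (a 0) (a 3) (a 1), sahiE_three_swap12 μ (a 0) (a 1) (a 3)]; exact h.e3_013) h.p3_23 (by show 0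 ≤ sahiE μ 3 ![a 2 * a 0, a 3, a 1]; rw [show a 2 * a 0 = a 0 * a 2 from mul_comm _ _, sahiE_three_swap12 μ (a 0 * a 2) (a 1) (a 3)]; exact h.p3_02) (by show 0 ≤ sahiE μ 3 ![a 3 * a 0, a 2, a 1]; rw [show a 3 * a 0 = a 0 * a 3 from mul_comm _ _, sahiE_three_swap12 μ (a 0 * a 3) (a 1) (a 2)]; exact h.p3_03) (by show 0 ≤ sahiE μ 3 ![a 2 * a 1, a 3, a 0]; rw [show a 2 * a 1 = a 1 * a 2 from mul_comm _ _, sahiE_three_swap12 μ (a 1 * a 2) (a 0) (a 3)]; exact h.p3_12) (by show 0 ≤ sahiE μ 3 ![a 3 * a 1, a 2, a 0]; rw [show a 3 * a 1 = a 1 * a 3 from mul_comm _ _, sahiE_three_swap12 μ (a 1 * a 3) (a 0) (a 2)]; exact h.p3_13) h.p3_01 (by show 0 ≤ sahiE μ 4 ![a 2, a 3, a 0, a 1]; rw [sahiE_four_perm2301]; exact h.e4)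
  -- e4
  · exact coinFour_e4_lat μ ν hμ0 hμ1 hν0 hν1 hμ2 a ha0 ha1 ham c hc
      h.e3_012 h.e3_013 h.e3_023 h.e3_123 h.p3_01 h.p3_02 h.p3_12 h.p3_03 h.p3_13 h.p3_23 h.e4

end Summit.CriticalPhenomena.PercolationContinuityZ3.Theorems.SahiH4Plus

end
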